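import Summits.ResolutionOfSingularities.ResolutionOfSingularities.Theorems.FrobeniusLadderFRationalResolutionEtaleRoofExtraction
import HarnessLib

/-!
# Crux `FrobeniusLadder.FRationalResolution` (stmt-ResolutionOfSingularities-15317), line `redirect`,
# stub `stub_diagonalizableQuotientResolution` — **localization package for étale roofs** (brick P7-c3′ of memo
# MEMO-15317-leafhand2-g8 §8–§9, shrinking half: after `…EtaleRoofExtraction` the chart ring `C'` is shrunk to a
# basic open on which the three centres `𝔭_x C'`, `𝔔`, `(χ s) C'` coincide, keeping `Γ(X,U) → C'` étale and
# `Spec C' → Spec C` an open immersion)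

* `away_package` — for `φ : B → C'` étale, `l : C → C'` with `Spec l` an open immersion and a prime `𝔔 ∌ g`: the
  composites to `C'_g` are again étale / an open immersion on `Spec`, and `𝔔 C'_g` is a prime contracting to `𝔔`;
* **`exists_equalized_ring_data`** — given moreover `𝔔 ∩ B = 𝔭`, `𝔔 ∩ C = 𝔓`, `J ≤ 𝔓` with `𝔓 C_𝔓 ≤ J C_𝔓`
  (`C'` Noetherian): there are `C''`, `φ'' : B → C''` étale, `l'' : C → C''` with `Spec l''` an open immersion and a
  prime `𝔔''` over `𝔭` and `𝔓` with **`J C'' = 𝔭 C''`** (two successive basic-open shrinkings by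
  `…FibreReduced.exists_away_map_le_of_map_atPrime_le`, unramifiedness of `φ` and `l` at `𝔔`).

Honest label: ring plumbing toward ONE leaf stub (no stub, crux or summit closed). No definitions, no named facts,
no sorry. [cite: StacksProject, Tag 00UW] [cite: GortzWedhorn2020, Prop. 13.91]
-/

noncomputable section

-- single-problem summit: the doubled namespace component is forced
set_option linter.dupNamespace false

open CategoryTheory AlgebraicGeometry TopologicalSpace
open IsLocalRing Literature.AlgebraicGeometry.Resolution
open Summit.ResolutionOfSingularities.ResolutionOfSingularities.Theorems.FRationalResolution.EtaleRoofExtraction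

namespace Summit.ResolutionOfSingularities.ResolutionOfSingularities.Theorems.FRationalResolution.EtaleRoofLocalization

/-- **Shrinking the chart ring to a basic open `D(g) ∋ 𝔔`** keeps `B → C'` étale, `Spec C' → Spec C` an open
immersion, and `𝔔` a prime. [cite: GortzWedhorn2020, Prop. 13.91] -/
theorem away_package {B C C' : Type} [CommRing B] [CommRing C] [CommRing C'] (φ : B →+* C') (hφ : φ.Etale)
    (l : C →+* C') (hl : IsOpenImmersion (Spec.map (CommRingCat.ofHom l))) (𝔔 : Ideal C') [h𝔔 : 𝔔.IsPrime]
    (g : C') (hg : g ∉ 𝔔) :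
    ((algebraMap C' (Localization.Away g)).comp φ).Etale ∧
      IsOpenImmersion (Spec.map (CommRingCat.ofHom ((algebraMap C' (Localization.Away g)).comp l))) ∧
      (𝔔.map (algebraMap C' (Localization.Away g))).IsPrime ∧
      (𝔔.map (algebraMap C' (Localization.Away g))).comap (algebraMap C' (Localization.Away g)) = 𝔔 := by
  haveI : IsOpenImmersion (Spec.map (CommRingCat.ofHom (algebraMap C' (Localization.Away g)))) :=
    IsOpenImmersion.of_isLocalization g
  have hdisj : Disjoint ((Submonoid.powers g : Submonoid C') : Set C') (𝔔 : Set C') := by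
    refine Set.disjoint_left.mpr ?_
    rintro x ⟨m, rfl⟩ hx
    exact hg (h𝔔.mem_of_pow_mem m hx)
  refine ⟨?_, ?_, IsLocalization.isPrime_of_isPrime_disjoint (Submonoid.powers g) _ 𝔔 h𝔔 hdisj,
    IsLocalization.under_map_of_isPrime_disjoint (Submonoid.powers g) (Localization.Away g) h𝔔 hdisj⟩
  · have h1 : Etale (Spec.map (CommRingCat.ofHom φ)) :=
      (HasRingHomProperty.Spec_iff (P := @Etale)).mpr hφ
    have h2 : Etale (Spec.map (CommRingCat.ofHom ((algebraMap C' (Localization.Away g)).comp φ))) := by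
      rw [CommRingCat.ofHom_comp, Spec.map_comp]; infer_instance
    exact (HasRingHomProperty.Spec_iff (P := @Etale)).mp h2
  · rw [CommRingCat.ofHom_comp, Spec.map_comp]; infer_instance

/-- **Equalizing the three centres on a basic open.** See the module docstring. [cite: StacksProject, Tag 00UW]
[cite: GortzWedhorn2020, Prop. 13.91] -/
theorem exists_equalized_ring_data {B C C' : Type} [CommRing B] [CommRing C] [CommRing C'] [IsNoetherianRing C']
    (φ : B →+* C') (hφ : φ.Etale) (l : C →+* C') (hl : IsOpenImmersion (Spec.map (CommRingCat.ofHom l)))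
    (𝔭 : Ideal B) [𝔭.IsPrime] (𝔓 : Ideal C) [𝔓.IsPrime] (𝔔 : Ideal C') [h𝔔 : 𝔔.IsPrime]
    (h𝔔φ : 𝔔.comap φ = 𝔭) (h𝔔l : 𝔔.comap l = 𝔓) (J : Ideal C) (hJ𝔓 : J ≤ 𝔓)
    (hJ : 𝔓.map (algebraMap C (Localization.AtPrime 𝔓)) ≤ J.map (algebraMap C (Localization.AtPrime 𝔓))) :
    ∃ (C'' : Type) (_ : CommRing C'') (_ : IsNoetherianRing C'') (φ'' : B →+* C'') (_ : φ''.Etale)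
      (l'' : C →+* C'') (_ : IsOpenImmersion (Spec.map (CommRingCat.ofHom l''))) (𝔔'' : Ideal C'')
      (_ : 𝔔''.IsPrime), 𝔔''.comap φ'' = 𝔭 ∧ 𝔔''.comap l'' = 𝔓 ∧ J.map l'' = 𝔭.map φ'' := by
  -- first shrinking: `𝔔 C₁ ≤ 𝔭 C₁`
  have h1 : 𝔔.map (algebraMap C' (Localization.AtPrime 𝔔)) ≤
      (𝔭.map φ).map (algebraMap C' (Localization.AtPrime 𝔔)) := by
    rw [Localization.AtPrime.map_eq_maximalIdeal, Ideal.map_map,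
      map_comp_eq_maximalIdeal_of_etale φ hφ 𝔭 𝔔 h𝔔φ]
  obtain ⟨g₁, hg₁, hle₁⟩ :=
    FibreReduced.exists_away_map_le_of_map_atPrime_le 𝔔 𝔔 (𝔭.map φ) (IsNoetherian.noetherian 𝔔) h1
  obtain ⟨hφ₁, hl₁, h𝔔₁, hc₁⟩ := away_package φ hφ l hl 𝔔 g₁ hg₁
  set C₁ := Localization.Away g₁ with hC₁
  set φ₁ := (algebraMap C' C₁).comp φ with hφ₁def
  set l₁ := (algebraMap C' C₁).comp l with hl₁def
  set 𝔔₁ := 𝔔.map (algebraMap C' C₁) with h𝔔₁def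
  haveI := h𝔔₁
  haveI : IsNoetherianRing C₁ := IsLocalization.isNoetherianRing (Submonoid.powers g₁) C₁ inferInstance
  have h𝔔₁φ : 𝔔₁.comap φ₁ = 𝔭 := by rw [hφ₁def, ← Ideal.comap_comap, hc₁, h𝔔φ]
  have h𝔔₁l : 𝔔₁.comap l₁ = 𝔓 := by rw [hl₁def, ← Ideal.comap_comap, hc₁, h𝔔l]
  have hle₁' : 𝔔₁ ≤ 𝔭.map φ₁ := by rw [h𝔔₁def, hφ₁def, ← Ideal.map_map]; exact hle₁
  -- second shrinking: `𝔔₁ C₂ ≤ J C₂`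
  have h2 : 𝔔₁.map (algebraMap C₁ (Localization.AtPrime 𝔔₁)) ≤
      (J.map l₁).map (algebraMap C₁ (Localization.AtPrime 𝔔₁)) := by
    have hl₁et : l₁.Etale := by
      haveI := hl₁
      exact (HasRingHomProperty.Spec_iff (P := @Etale)).mp (inferInstance : Etale (Spec.map (CommRingCat.ofHom l₁)))
    have hJ' : 𝔓.map (algebraMap C (Localization.AtPrime 𝔓)) ≤ J.map (algebraMap C (Localization.AtPrime 𝔓)) := hJ
    have h3 := map_map_le_of_comap_eq l₁ 𝔓 𝔔₁ h𝔔₁l J hJ'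
    rw [Localization.AtPrime.map_eq_maximalIdeal, ← map_comp_eq_maximalIdeal_of_etale l₁ hl₁et 𝔓 𝔔₁ h𝔔₁l,
      ← Ideal.map_map]
    exact h3
  obtain ⟨g₂, hg₂, hle₂⟩ :=
    FibreReduced.exists_away_map_le_of_map_atPrime_le 𝔔₁ 𝔔₁ (J.map l₁) (IsNoetherian.noetherian 𝔔₁) h2
  obtain ⟨hφ₂, hl₂, h𝔔₂, hc₂⟩ := away_package φ₁ hφ₁ l₁ hl₁ 𝔔₁ g₂ hg₂
  set C₂ := Localization.Away g₂ with hC₂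
  set φ₂ := (algebraMap C₁ C₂).comp φ₁ with hφ₂def
  set l₂ := (algebraMap C₁ C₂).comp l₁ with hl₂def
  set 𝔔₂ := 𝔔₁.map (algebraMap C₁ C₂) with h𝔔₂def
  haveI := h𝔔₂
  haveI : IsNoetherianRing C₂ := IsLocalization.isNoetherianRing (Submonoid.powers g₂) C₂ inferInstance
  have h𝔔₂φ : 𝔔₂.comap φ₂ = 𝔭 := by rw [hφ₂def, ← Ideal.comap_comap, hc₂, h𝔔₁φ]
  have h𝔔₂l : 𝔔₂.comap l₂ = 𝔓 := by rw [hl₂def, ← Ideal.comap_comap, hc₂, h𝔔₁l]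
  refine ⟨C₂, inferInstance, inferInstance, φ₂, hφ₂, l₂, hl₂, 𝔔₂, h𝔔₂, h𝔔₂φ, h𝔔₂l, le_antisymm ?_ ?_⟩
  · -- `J C₂ ≤ 𝔔₂ ≤ 𝔭 C₂`
    have hJ𝔔₂ : J.map l₂ ≤ 𝔔₂ := by rw [Ideal.map_le_iff_le_comap, h𝔔₂l]; exact hJ𝔓
    refine hJ𝔔₂.trans ?_
    rw [h𝔔₂def, hφ₂def, ← Ideal.map_map]
    exact Ideal.map_mono hle₁'
  · -- `𝔭 C₂ ≤ 𝔔₂ ≤ J C₂`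
    have h𝔭𝔔₂ : 𝔭.map φ₂ ≤ 𝔔₂ := by rw [Ideal.map_le_iff_le_comap, h𝔔₂φ]
    refine h𝔭𝔔₂.trans ?_
    rw [h𝔔₂def, hl₂def, ← Ideal.map_map]
    exact hle₂

end Summit.ResolutionOfSingularities.ResolutionOfSingularities.Theorems.FRationalResolution.EtaleRoofLocalization

end
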